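import Summits.BirchSwinnertonDyer.BirchSwinnertonDyer.Theses.GenusKolyvaginAtTwo
import HarnessLib

/-!
# Route `GenusKolyvaginAtTwo` — the assembly item (stmt-BirchSwinnertonDyer-22140)

The route's `Assembly` decl kept its rev-0 FOUR-binder signature

  `GenusPrimitiveSupplyAtTwo → KolyvaginExactAtTwo → ExactDescentAtTwo → OffHabitatResidualAtTwo → Rank1Residual.NonCMAtTwo`,

while the rev-1 deciding theorem `closes` (critic idea-crit-5, price (1)) takes a FIFTH binder `MinimalTwinBSDTwo`
(crux #6, stmt-BirchSwinnertonDyer-22985: BSD₂ for non-CM curves of analytic rank `1` with `#Sel₂ = 2`). The four-binder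
implication is nevertheless TRUE as typed, for a purely logical reason recorded by the refuter pass on the item
(refuter-parity-tllh-ref-1 g3, 2026-08-27T23:32Z, candidate `Proof22140.lean`): the declared residual
`OffHabitatResidualAtTwo` (crux #5) covers every non-CM curve of analytic rank `≤ 1` that is NOT on the habitat
`(analyticRank = 0 ∧ 2-adically surjective ∧ odd Tamagawa product ∧ optimal odd-Manin parametrisation)`, and a curve of
analytic rank `1` fails the first habitat clause — so the residual already delivers `BSDp W 2` for the 2-Selmer-minimal
rank-one twins, i.e. `OffHabitatResidualAtTwo → MinimalTwinBSDTwo` (`minimalTwinBSDTwo_of_offHabitatResidualAtTwo`).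
Feeding that into `closes` proves `Assembly` BY NAME (`assembly_proof`).

What this file does NOT say: nothing here touches the mathematics of cruxes #2–#6 (all open); in particular crux #6 is
not proved — it is only shown to be logically subsumed by the residual #5 AS TYPED (the planner may restate `Assembly`
with the fifth binder, or shrink the residual to exclude the rank-one Sel₂-minimal slice, for honesty of accounting).
BSD is not proved by any of this.
-/

set_option linter.dupNamespace false -- `Summit.BirchSwinnertonDyer.BirchSwinnertonDyer.…` is the tree's layout (D-0017)

namespace Summit.BirchSwinnertonDyer.BirchSwinnertonDyer.Theorems.GenusAssembly

open Summit.BirchSwinnertonDyer.BirchSwinnertonDyer.Theses.GenusKolyvaginAtTwo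

/-- **Crux #6 is subsumed by the residual #5 (as typed).** If every non-CM curve `W/ℚ` of analytic rank `≤ 1` off the
habitat `(r_an = 0 ∧ ρ_{W,2^∞} onto ∧ odd Tamagawa product ∧ optimal odd-Manin parametrisation)` satisfies `BSDp W 2`
(`OffHabitatResidualAtTwo`), then so does every non-CM curve with `r_an = 1` and `#Sel₂(W) = 2` (`MinimalTwinBSDTwo`):
`r_an = 1` gives `r_an ≤ 1` and refutes the habitat clause `r_an = 0`; the instance `NeZero (W.conductorNorm ℤ)` the
residual needs comes from `WeierstrassCurve.conductorNorm_pos_holds`. The `#Sel₂ = 2` binder is not used. [folklore] -/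
theorem minimalTwinBSDTwo_of_offHabitatResidualAtTwo (hR : OffHabitatResidualAtTwo) : MinimalTwinBSDTwo := by
  intro W _ _ hcm hr _
  haveI : NeZero (W.conductorNorm ℤ) := ⟨(W.conductorNorm_pos_holds).ne'⟩
  exact hR W hcm hr.le (fun h => absurd h.1 (by rw [hr]; exact one_ne_zero))

/-- **The assembly item of route `GenusKolyvaginAtTwo` (stmt-BirchSwinnertonDyer-22140), BY NAME.**
`GenusPrimitiveSupplyAtTwo → KolyvaginExactAtTwo → ExactDescentAtTwo → OffHabitatResidualAtTwo → Rank1Residual.NonCMAtTwo`: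
the composition of the route's deciding theorem `closes` (rev 2) with its `MinimalTwinBSDTwo` input supplied by the
residual via `minimalTwinBSDTwo_of_offHabitatResidualAtTwo` — INLINED (revision 2026-08-28, same seat), so that this
proof no longer depends on the binder list of `closes`, which grows with route revisions (rev 5: nine binders, the third
now `ExactDescentAtTwoOfFourFacts`). For `W` non-CM with `r_an ≤ 1`: on the habitat, `GenusPrimitiveSupplyAtTwo` yields
`(K, Dt, y_K, M₀, n, P(n) ∉ 2E(K[n]), Wd)`, `KolyvaginExactAtTwo` turns the certificate into `#Ш(E/K)[2^∞] = 4^{M₀}`,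
the residual gives `BSD₂(Wd)` for the twin (analytic rank `1`, hence off the habitat), and `ExactDescentAtTwo`
concludes `BSD₂(W)`; off the habitat, the residual. Pure logic; no crux is proved here. [folklore] -/
theorem assembly_proof : Assembly := by
  intro hP hX hG hR W _ _ hcm hr
  haveI : NeZero (W.conductorNorm ℤ) := ⟨(W.conductorNorm_pos_holds).ne'⟩
  by_cases hH : (W.analyticRank = 0 ∧ (∀ n : ℕ, 0 < n → W.HasSurjectiveModNGaloisRep ((2 : ℤ) ^ n)) ∧
        Odd W.tamagawaProduct ∧
        ∃ Dt : Literature.NumberTheory.EllipticCurves.ModularForms.ModularParametrizationData W (W.conductorNorm ℤ),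
          (∀ z ∈ Dt.L.lattice, ∃ w ∈ Literature.NumberTheory.EllipticCurves.ModularForms.periodLattice Dt.f,
            z = (Dt.c : ℂ) * w) ∧ Odd Dt.c)
  · obtain ⟨hr0, hρ, hT, hopt⟩ := hH
    obtain ⟨K, _, _, hIQ, hodd, h3, hHe, hsq1, hsq2, Dt, β, ι, d₁, hoptDt, hc, hy, M₀, hdiv, hndiv,
      n, d, hn, hKoly, hPn, Wd, _, _, hWd, hcmd, hrd, hSel⟩ := hP W hcm hr0 hρ hT hopt
    have hex := hX W hcm K hIQ hodd h3 hHe hsq1 hsq2 hρ Dt β ι d₁ hy M₀ hdiv hndiv n d hn hKoly hPn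
    have hBd : Literature.NumberTheory.EllipticCurves.BSDp Wd 2 :=
      minimalTwinBSDTwo_of_offHabitatResidualAtTwo hR Wd hcmd hrd hSel
    exact hG W hcm hr0 hρ hT K hIQ hodd h3 hHe Dt hoptDt hc β ι d₁ hy M₀ hdiv hndiv hex Wd hWd hSel hBd
  · exact hR W hcm hr hH

end Summit.BirchSwinnertonDyer.BirchSwinnertonDyer.Theorems.GenusAssembly
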